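import Literature.Geometry.Kaehler.RiemannSurfaceHolomorphicMapFundamentalGroupIndex
import Literature.Geometry.Kaehler.RiemannSurfaceGaloisCovering
import Literature.Geometry.Kaehler.RiemannSurfaceIdentityTheorem
import Literature.Topology.CoveringSpaces.CoveringNormalClosureQuotient
import HarnessLib

/-!
# Holomorphic covering maps of compact Riemann surfaces are local biholomorphisms; the Galois closure of an unramified holomorphic covering

Topic `Literature/Geometry/Kaehler` — sequel of `RiemannSurfaceHolomorphicMapFundamentalGroupIndex` (the étale
factorisation `F = q ∘ F̃` of a non-constant holomorphic map of compact connected Riemann surfaces),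
`RiemannSurfaceGaloisCovering` (the free holomorphic deck action of `π₁(N, y₀) ⧸ K` on the compact Riemann surface
`Ñ ⧸ K`) and of the lane's topological Galois closure `Topology/CoveringSpaces/CoveringNormalClosure[Quotient]`
(Hatcher §1.3 Prop. 1.33, 1.36, 1.39, Ex. 16: a connected cover `E → X` is dominated by the normal cover
`X̃ ⧸ ker(monodromy) = X̃ ⧸ core(p_* π₁(E))`, and is a quotient of it).

Setting: `M`, `N` compact connected Riemann surfaces, `F : M → N` holomorphic AND a topological covering map
(`IsCoveringMap F`, i.e. an unramified holomorphic covering), `x₀ : M`, `H = F_* π₁(M, x₀) ≤ π₁(N, F x₀)`.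

## What is proved (everything; no definitions, no instances, no named facts)

* §1 `IsCoveringMap.finite_preimage_singleton_of_compactSpace`, `IsCoveringMap.exists_apply_ne_of_compactSpace`
  (fibres of a covering by a compact space are finite; such a covering of a Riemann surface is non-constant);
  **`isLocalDiffeomorph_of_isCoveringMap`** — an unramified holomorphic covering map of compact connected Riemann
  surfaces is a local biholomorphism for the GIVEN complex structures (`IsLocalDiffeomorph 𝓘(ℂ, ℂ) 𝓘(ℂ, ℂ) ω F`):
  in the étale factorisation `F = q ∘ F̃` the map of coverings `F̃ : M → Y` is a one-sheeted covering, hence a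
  biholomorphism (Farkas–Kra I.1.6 / Miranda II.4), and `q` is a local biholomorphism by construction
  (Forster 4.6);
* §2 rigidity consequences (Forster 4.6 «lifts along unbranched holomorphic coverings are holomorphic»):
  **`mdifferentiable_of_comp_eq_of_isCoveringMap`** (a continuous map `s : T → M` over `N` from a Riemann surface
  with `F ∘ s` holomorphic is holomorphic), `mdifferentiable_of_comp_eq_self` ∕ `mdifferentiable_homeomorph_deck`
  (deck transformations of `F` are biholomorphic);
* §3 **`exists_galois_cover_of_le_range`** — for every `K ⊴ π₁(N, F x₀)` of finite index with `K ≤ H` the compact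
  connected Riemann surface `T = Ñ ⧸ K` (universe of `N`) carries a free holomorphic action of `G = π₁(N, F x₀) ⧸ K`
  whose orbit map `t : T → N` is a holomorphic covering with `[π₁ : K]` sheets and `t_* π₁(T) = K`, and there is a
  HOLOMORPHIC covering map `s : T → M` onto `M` with `F ∘ s = t`, `s [c] = x₀`, which is the quotient covering map
  of the subgroup `{g ∈ G | s ∘ g = s}` (so `M ≅ T ⧸ {g | s ∘ g = s}` over `N`); `g(T) − 1 = [π₁ : K] (g(N) − 1)`;
  **`exists_galois_closure`** — the case `K = core(H)`, the normal core (= kernel of the monodromy representation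
  on `F⁻¹(F x₀)`, `ker_monodromyPerm_eq_normalCore`): THE GALOIS CLOSURE of the unramified holomorphic covering
  `F`; it is the smallest Galois cover of `N` dominating `M` in the sense that every normal subgroup of
  `π₁(N, F x₀)` inside `H` lies in `core(H)` (Mathlib `Subgroup.normal_le_normalCore`).

## References
* A. Hatcher, *Algebraic Topology*, CUP 2002, §1.3 Prop. 1.33 (p. 61), Prop. 1.36 (p. 68), Prop. 1.39 (p. 71),
  Exercise 16 (p. 80). [HatcherAT2002]
* O. Forster, *Lectures on Riemann Surfaces*, GTM 81, Springer 1981, §4 Thm. 4.6, §5 (Galois coverings). [Forster1981]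
* H. M. Farkas, I. Kra, *Riemann Surfaces*, 2nd ed., GTM 71, Springer 1992, I.1.6, I.2.7. [FarkasKra1992]
* R. Miranda, *Algebraic Curves and Riemann Surfaces*, AMS 1995, Chapter III Theorem 3.4. [Miranda1995]
-/

noncomputable section

open Set Function Filter TopologicalSpace MulAction
open _root_.Topology
open scoped Manifold ContDiff

namespace Literature.Geometry.Kaehler

open Literature.Topology.CoveringSpaces

namespace RiemannSurface

universe u v

variable {M : Type u} [TopologicalSpace M] [ChartedSpace ℂ M] [ConnectedSpace M] [IsManifold 𝓘(ℂ, ℂ) ω M]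
  [CompactSpace M] [T2Space M]
  {N : Type v} [TopologicalSpace N] [ChartedSpace ℂ N] [ConnectedSpace N] [IsManifold 𝓘(ℂ, ℂ) ω N]
  [CompactSpace N] [T2Space N]
  {F : M → N}

/-! ### §1 An unramified holomorphic covering of compact Riemann surfaces is a local biholomorphism -/

omit [ChartedSpace ℂ M] [ConnectedSpace M] [IsManifold 𝓘(ℂ, ℂ) ω M] [T2Space M] [ChartedSpace ℂ N]
  [ConnectedSpace N] [IsManifold 𝓘(ℂ, ℂ) ω N] [CompactSpace N] in
/-- The fibres of a covering map with compact total space (over a `T₁` base) are finite: they are closed and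
discrete. [cite: HatcherAT2002, §1.3 (covering spaces, p. 56)] -/
theorem _root_.IsCoveringMap.finite_preimage_singleton_of_compactSpace (hc : IsCoveringMap F) (y : N) :
    (F ⁻¹' {y}).Finite := by
  haveI : DiscreteTopology (F ⁻¹' {y}) := (hc y).1
  have hK : IsCompact (F ⁻¹' {y}) := (isClosed_singleton.preimage hc.continuous).isCompact
  haveI : Finite (F ⁻¹' {y}) := @finite_of_compact_of_discrete _ _ (isCompact_iff_compactSpace.1 hK) _
  exact Set.toFinite _

omit [ChartedSpace ℂ M] [IsManifold 𝓘(ℂ, ℂ) ω M] [T2Space M] [IsManifold 𝓘(ℂ, ℂ) ω N] [CompactSpace N] in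
/-- A covering map from a non-empty compact space to a connected Riemann surface takes (at least) two values: it is
onto (`IsCoveringMap.surjective_of_finite`) and a Riemann surface is infinite.
[cite: HatcherAT2002, §1.3 (covering spaces, p. 56)] -/
theorem _root_.IsCoveringMap.exists_apply_ne_of_compactSpace (hc : IsCoveringMap F) : ∃ a b, F a ≠ F b := by
  obtain ⟨x₀⟩ : Nonempty M := inferInstance
  have hs := hc.surjective_of_finite hc.finite_preimage_singleton_of_compactSpace
  haveI : Nonempty N := ⟨F x₀⟩
  haveI : Infinite N := infinite_of_chartedSpace
  obtain ⟨y, hy⟩ := exists_ne (F x₀)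
  obtain ⟨b, rfl⟩ := hs y
  exact ⟨b, x₀, hy⟩

omit [T2Space M] [CompactSpace N] in
/-- **An unramified holomorphic covering map of compact connected Riemann surfaces is a local biholomorphism**
(for the given complex structures of `M` and `N`): `IsLocalDiffeomorph 𝓘(ℂ, ℂ) 𝓘(ℂ, ℂ) ω F`.  Proof: in the étale
factorisation `F = q ∘ F̃` (`exists_etale_factorisation`) the holomorphic map of coverings `F̃ : M → Y` is a covering
map (Hatcher Ex. 1.3.16) with connected total space and `F̃_*` onto `π₁(Y)`, hence one-sheeted, i.e. bijective,
hence a biholomorphism (`exists_homeomorph_mdifferentiable_symm`, holomorphic = `C^ω`); and `q` is a local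
biholomorphism. [cite: Forster1981, §4 Thm. 4.6] [cite: HatcherAT2002, §1.3 Prop. 1.33, 1.36, Exercise 16]
[cite: FarkasKra1992, I.1.6 Proposition] -/
theorem isLocalDiffeomorph_of_isCoveringMap (hF : MDifferentiable 𝓘(ℂ, ℂ) 𝓘(ℂ, ℂ) F) (hc : IsCoveringMap F) :
    IsLocalDiffeomorph 𝓘(ℂ, ℂ) 𝓘(ℂ, ℂ) ω F := by
  have hne : ∃ a b, F a ≠ F b := hc.exists_apply_ne_of_compactSpace
  obtain ⟨x₀, -, -⟩ := id hne
  obtain ⟨Y, i1, i2, i3, i4, i5, i6, q, hq, Ft, hx₀, hqd, hFtd, hFts, hqFt, hcard, hrange, htop, hqld⟩ :=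
    exists_etale_factorisation hF hne x₀
  haveI := pathConnectedSpace_of_connectedSpace M
  haveI := pathConnectedSpace_of_connectedSpace Y
  haveI := ChartedSpace.locallyPathConnectedSpace ℂ N
  -- `F̃` is a covering map (a map of coverings over the locally connected `N`)
  have hFtc : IsCoveringMap (Ft : M → Y) := hc.of_comp_eq hq Ft.continuous hqFt
  -- with one sheet: `[π₁(Y) : F̃_* π₁(M)] = 1`
  have h1 : Nat.card ((Ft : M → Y) ⁻¹' {Ft x₀}) = 1 := by
    rw [← CoverMonodromy.index_range_mapOfEq_eq_natCard_fiber hFtc (⟨x₀, rfl⟩ : (Ft : M → Y) ⁻¹' {Ft x₀}),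
      Literature.AlgebraicTopology.FundamentalGroup.index_range_mapOfEq]
    have hFt_eta : (⟨(Ft : M → Y), hFtc.continuous⟩ : C(M, Y)) = Ft := rfl
    rw [hFt_eta, htop, Subgroup.index_top]
  have hinj : Injective (Ft : M → Y) := fun a b hab ↦ by
    have hcard1 : Nat.card ((Ft : M → Y) ⁻¹' {Ft a}) = 1 := by
      rw [hFtc.natCard_preimage_singleton_eq (Ft a) (Ft x₀)]; exact h1
    haveI : Subsingleton ((Ft : M → Y) ⁻¹' {Ft a}) := (Nat.card_eq_one_iff_unique.mp hcard1).1
    have h := Subsingleton.elim (⟨a, rfl⟩ : (Ft : M → Y) ⁻¹' {Ft a}) ⟨b, hab.symm⟩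
    exact congrArg Subtype.val h
  haveI := (inferInstance : ConnectedSpace M).toPreconnectedSpace
  obtain ⟨e, he, hesymm⟩ := exists_homeomorph_mdifferentiable_symm hFtd ⟨hinj, hFts⟩
  have hed : MDifferentiable 𝓘(ℂ, ℂ) 𝓘(ℂ, ℂ) e := by rw [he]; exact hFtd
  -- `F̃` as a biholomorphism `Φ`, and `F = q ∘ Φ`
  let Φ : Diffeomorph 𝓘(ℂ, ℂ) 𝓘(ℂ, ℂ) M Y ω :=
    { toEquiv := e.toEquiv
      contMDiff_toFun := contMDiff_of_mdifferentiable hed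
      contMDiff_invFun := contMDiff_of_mdifferentiable hesymm }
  have hΦ : ∀ x, Φ x = Ft x := fun x ↦ congrFun he x
  have hFeq : F = q ∘ Φ := funext fun x ↦ by rw [comp_apply, hΦ, hqFt]
  rw [hFeq]
  exact fun x ↦ IsLocalDiffeomorphAt.comp (hf := Φ.isLocalDiffeomorph x) (hg := hqld (Φ x))

/-! ### §2 Rigidity over an unramified holomorphic covering -/

omit [T2Space M] [CompactSpace N] in
/-- **Continuous maps over an unramified holomorphic covering are holomorphic**: if `F : M → N` is a holomorphic
covering map of compact connected Riemann surfaces, `T` a space charted over `ℂ`, `t : T → N` holomorphic and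
`s : T → M` continuous with `F ∘ s = t`, then `s` is holomorphic (Forster 4.6, via §1).
[cite: Forster1981, §4 Thm. 4.6] -/
theorem mdifferentiable_of_comp_eq_of_isCoveringMap (hF : MDifferentiable 𝓘(ℂ, ℂ) 𝓘(ℂ, ℂ) F)
    (hc : IsCoveringMap F) {T : Type*} [TopologicalSpace T] [ChartedSpace ℂ T] {t : T → N}
    (ht : MDifferentiable 𝓘(ℂ, ℂ) 𝓘(ℂ, ℂ) t) {s : T → M} (hs : Continuous s) (h : ∀ a, F (s a) = t a) :
    MDifferentiable 𝓘(ℂ, ℂ) 𝓘(ℂ, ℂ) s :=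
  mdifferentiable_of_comp_eq (isLocalDiffeomorph_of_isCoveringMap hF hc) hs ht h

omit [T2Space M] [CompactSpace N] in
/-- **Deck transformations of an unramified holomorphic covering are holomorphic**: a continuous `φ : M → M`
with `F ∘ φ = F` is holomorphic. [cite: Forster1981, §4 Thm. 4.6, §5 (Galois coverings)] -/
theorem mdifferentiable_of_comp_eq_self (hF : MDifferentiable 𝓘(ℂ, ℂ) 𝓘(ℂ, ℂ) F) (hc : IsCoveringMap F)
    {φ : M → M} (hφ : Continuous φ) (h : ∀ x, F (φ x) = F x) : MDifferentiable 𝓘(ℂ, ℂ) 𝓘(ℂ, ℂ) φ :=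
  mdifferentiable_of_comp_eq_of_isCoveringMap hF hc hF hφ h

omit [T2Space M] [CompactSpace N] in
/-- A deck homeomorphism `φ` of an unramified holomorphic covering `F` (i.e. `F ∘ φ = F`) is a biholomorphism:
`φ` and `φ⁻¹` are holomorphic. [cite: Forster1981, §4 Thm. 4.6, §5 (Galois coverings)] -/
theorem mdifferentiable_homeomorph_deck (hF : MDifferentiable 𝓘(ℂ, ℂ) 𝓘(ℂ, ℂ) F) (hc : IsCoveringMap F)
    (φ : M ≃ₜ M) (h : F ∘ φ = F) :
    MDifferentiable 𝓘(ℂ, ℂ) 𝓘(ℂ, ℂ) φ ∧ MDifferentiable 𝓘(ℂ, ℂ) 𝓘(ℂ, ℂ) φ.symm := by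
  refine ⟨mdifferentiable_of_comp_eq_self hF hc φ.continuous (fun x ↦ congrFun h x),
    mdifferentiable_of_comp_eq_self hF hc φ.symm.continuous fun x ↦ ?_⟩
  have := congrFun h (φ.symm x)
  rw [comp_apply, φ.apply_symm_apply] at this
  exact this.symm

/-! ### §3 The Galois closure of an unramified holomorphic covering -/

omit [T2Space M] in
/-- **Galois covers of `N` dominating the unramified holomorphic covering `F : M → N`.**  Let `M`, `N` be compact
connected Riemann surfaces, `F` a holomorphic covering map, `x₀ : M`, and `K ⊴ π₁(N, F x₀)` a normal subgroup of
finite index contained in `H = F_* π₁(M, x₀)`.  Then on the compact connected Riemann surface `T = Ñ ⧸ K` (with the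
complex structure pulled back from `N`; in the universe of `N`) the finite group `G = π₁(N, F x₀) ⧸ K` acts freely by
biholomorphisms, the projection `t : T → N` is a holomorphic covering map which is the orbit map of `G`
(`t a = t b ⇔ b ∈ G • a`), with `[π₁ : K]` points in every fibre, `t_*` injective with image `K` at the base point
`[c]` over `F x₀`; and there is a holomorphic SURJECTIVE COVERING MAP `s : T → M` with `F ∘ s = t` and
`s [c] = x₀` (Hatcher 1.33: `t_* π₁(T) = K ≤ H`; holomorphic by §2), which is the quotient covering map of the
subgroup `{g ∈ G | s ∘ g = s}` of `G` (Hatcher Ex. 1.3.16), so that `M ≅ T ⧸ {g | s ∘ g = s}` over `N`; finally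
`g(T) − 1 = [π₁ : K] · (g(N) − 1)`. [cite: HatcherAT2002, §1.3 Prop. 1.33 (p. 61), Prop. 1.36 (p. 68), Prop. 1.39 (p. 71), Exercise 16 (p. 80)]
[cite: Forster1981, §4 Thm. 4.6, §5] [cite: FarkasKra1992, I.2.7] [cite: Miranda1995, Chapter III Theorem 3.4] -/
theorem exists_galois_cover_of_le_range (hF : MDifferentiable 𝓘(ℂ, ℂ) 𝓘(ℂ, ℂ) F) (hc : IsCoveringMap F) (x₀ : M)
    (K : Subgroup (FundamentalGroup N (F x₀))) [K.Normal] [K.FiniteIndex]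
    (hK : K ≤ (FundamentalGroup.map (⟨F, hF.continuous⟩ : C(M, N)) x₀).range) :
    ∃ (T : Type v) (_ : TopologicalSpace T) (_ : ChartedSpace ℂ T) (_ : IsManifold 𝓘(ℂ, ℂ) ω T)
      (_ : CompactSpace T) (_ : T2Space T) (_ : ConnectedSpace T)
      (_ : MulAction (FundamentalGroup N (F x₀) ⧸ K) T) (t : T → N) (ht : IsCoveringMap t) (t₀ : T)
      (ht₀ : t t₀ = F x₀) (s : T → M) (S : Subgroup (FundamentalGroup N (F x₀) ⧸ K)),
      HolomorphicSMul (FundamentalGroup N (F x₀) ⧸ K) T ∧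
        (∀ a : T, stabilizer (FundamentalGroup N (F x₀) ⧸ K) a = ⊥) ∧
        MDifferentiable 𝓘(ℂ, ℂ) 𝓘(ℂ, ℂ) t ∧ Surjective t ∧
        (∀ (g : FundamentalGroup N (F x₀) ⧸ K) (a : T), t (g • a) = t a) ∧
        (∀ a b : T, t a = t b ↔ ∃ g : FundamentalGroup N (F x₀) ⧸ K, g • b = a) ∧
        (∀ y, (t ⁻¹' {y}).ncard = K.index) ∧
        Injective (FundamentalGroup.mapOfEq (⟨t, ht.continuous⟩ : C(T, N)) ht₀) ∧
        (FundamentalGroup.mapOfEq (⟨t, ht.continuous⟩ : C(T, N)) ht₀).range = K ∧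
        IsCoveringMap s ∧ MDifferentiable 𝓘(ℂ, ℂ) 𝓘(ℂ, ℂ) s ∧ Surjective s ∧ (∀ a, F (s a) = t a) ∧
        s t₀ = x₀ ∧ IsQuotientCoveringMap s S ∧
        (∀ g : FundamentalGroup N (F x₀) ⧸ K, g ∈ S ↔ ∀ a, s (g • a) = s a) ∧
        (arithGenus T : ℤ) - 1 = K.index * ((arithGenus N : ℤ) - 1) := by
  haveI := pathConnectedSpace_of_connectedSpace N
  haveI := stronglyLocallyContractibleSpace_of_riemannSurface N
  haveI := pathConnectedSpace_of_connectedSpace M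
  -- the cover `T = Ñ ⧸ K` with its projection `t`
  let t : orbitRel.Quotient K (UniversalCover N (F x₀)) → N :=
    Quotient.lift UniversalCover.proj fun a b h ↦ by
      obtain ⟨n, rfl⟩ := MulAction.mem_orbit_iff.mp h
      exact UniversalCover.proj_smul _ _
  have hq : ∀ a, t (Quotient.mk _ a) = UniversalCover.proj a := fun _ ↦ rfl
  letI := IsLocalHomeomorph.comapChartedSpace ℂ
    (UniversalCover.isCoveringMap_orbitLift_riemannSurface K hq).isLocalHomeomorph
  haveI := UniversalCover.isManifold_orbitQuotient K hq
  haveI := UniversalCover.compactSpace_orbitQuotient_riemannSurface K hq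
  haveI := UniversalCover.t2Space_orbitQuotient_riemannSurface K hq
  haveI := UniversalCover.connectedSpace_orbitQuotient_riemannSurface K (x₀ := F x₀)
  -- `K` acts trivially on the fibre `F⁻¹(F x₀)`: `K ≤ core(H) = ker (monodromy)`
  have hKker : K ≤ (hc.monodromyPerm (F x₀)).ker := by
    rw [ker_monodromyPerm_eq_normalCore hc (⟨x₀, rfl⟩ : F ⁻¹' {F x₀})]
    refine Subgroup.normal_le_normalCore.mpr fun γ hγ ↦ ?_
    obtain ⟨δ, hδ⟩ := hK hγ
    exact ⟨δ, by rw [← hδ]; exact Literature.AlgebraicTopology.FundamentalGroup.mapOfEq_rfl_apply _ _ δ⟩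
  -- the domination map `s : T → M` (Hatcher 1.33), a covering map (Ex. 1.3.16), holomorphic (§2)
  obtain ⟨s, hFs, hs0, hss⟩ :=
    UniversalCover.exists_map_orbitQuotient_of_le K hq hc (e₀ := x₀) rfl hKker
  have hFs' : ∀ a, F (s a) = t a := fun a ↦ congrFun hFs a
  have hsc : IsCoveringMap s := UniversalCover.isCoveringMap_of_comp_eq_orbitLift K hq hc s.continuous hFs
  have hsd : MDifferentiable 𝓘(ℂ, ℂ) 𝓘(ℂ, ℂ) s :=
    mdifferentiable_of_comp_eq_of_isCoveringMap hF hc (UniversalCover.mdifferentiable_orbitLift K hq)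
      s.continuous hFs'
  -- the subgroup of deck transformations of `t` preserving `s`
  let S : Subgroup (FundamentalGroup N (F x₀) ⧸ K) :=
    { carrier := {g | ∀ a, s (g • a) = s a}
      mul_mem' := fun {a b} ha hb c ↦ by rw [mul_smul, ha, hb]
      one_mem' := fun c ↦ by rw [one_smul]
      inv_mem' := fun {a} ha c ↦ by rw [← ha (a⁻¹ • c), smul_inv_smul] }
  have hsQ : IsQuotientCoveringMap s S :=
    UniversalCover.isQuotientCoveringMap_of_comp_eq_orbitLift K hq hc s.continuous hFs hss S fun _ ↦ Iff.rfl
  exact ⟨orbitRel.Quotient K (UniversalCover N (F x₀)), inferInstance, inferInstance, inferInstance, inferInstance,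
    inferInstance, inferInstance, inferInstance, t, UniversalCover.isCoveringMap_orbitLift_riemannSurface K hq,
    Quotient.mk _ (UniversalCover.base N (F x₀)), UniversalCover.orbitLift_base K hq, s, S,
    UniversalCover.holomorphicSMul_quotient K hq, UniversalCover.stabilizer_quotient_eq_bot K,
    UniversalCover.mdifferentiable_orbitLift K hq, UniversalCover.orbitLift_surjective_riemannSurface K hq,
    UniversalCover.orbitLift_smul K hq, fun _ _ ↦ UniversalCover.orbitLift_eq_iff K hq,
    UniversalCover.ncard_preimage_orbitLift_riemannSurface K hq,
    UniversalCover.mapOfEq_orbitLift_injective_riemannSurface K hq _,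
    UniversalCover.range_mapOfEq_orbitLift_riemannSurface K hq _, hsc, hsd, hss, hFs', hs0, hsQ,
    fun _ ↦ Iff.rfl, UniversalCover.arithGenus_orbitQuotient_sub_one_eq K hq⟩

omit [T2Space M] in
/-- **The Galois closure of an unramified holomorphic covering of compact Riemann surfaces.**  For a holomorphic
covering map `F : M → N` of compact connected Riemann surfaces and `x₀ : M`, let `H = F_* π₁(M, x₀)` and
`K = core(H)` its normal core — the kernel of the monodromy representation of `π₁(N, F x₀)` on the fibre
`F⁻¹(F x₀)` (`ker_monodromyPerm_eq_normalCore`), of finite index.  Then the compact connected Riemann surface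
`T = Ñ ⧸ K` is a GALOIS (normal) unramified holomorphic covering of `N` with group `G = π₁(N, F x₀) ⧸ core(H)`
acting freely by biholomorphisms, it dominates `M` through a holomorphic covering map `s : T → M`, `F ∘ s = t`,
which is itself the quotient map of a subgroup of `G`; and it is the smallest such: a normal subgroup of
`π₁(N, F x₀)` inside `H` lies in `core(H)` (Mathlib `Subgroup.normal_le_normalCore`), i.e. every Galois cover of
`N` dominating `M` dominates `T`.  (Hatcher Prop. 1.39 and Ex. 1.3.16 with the normal core; Forster §5.)
[cite: HatcherAT2002, §1.3 Prop. 1.33, Prop. 1.36, Prop. 1.39 (p. 71), Exercise 16 (p. 80)]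
[cite: Forster1981, §4 Thm. 4.6, §5] [cite: FarkasKra1992, I.2.7] -/
theorem exists_galois_closure (hF : MDifferentiable 𝓘(ℂ, ℂ) 𝓘(ℂ, ℂ) F) (hc : IsCoveringMap F) (x₀ : M) :
    ∃ (T : Type v) (_ : TopologicalSpace T) (_ : ChartedSpace ℂ T) (_ : IsManifold 𝓘(ℂ, ℂ) ω T)
      (_ : CompactSpace T) (_ : T2Space T) (_ : ConnectedSpace T)
      (_ : MulAction (FundamentalGroup N (F x₀) ⧸
        (FundamentalGroup.map (⟨F, hF.continuous⟩ : C(M, N)) x₀).range.normalCore) T)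
      (t : T → N) (ht : IsCoveringMap t) (t₀ : T) (ht₀ : t t₀ = F x₀) (s : T → M)
      (S : Subgroup (FundamentalGroup N (F x₀) ⧸
        (FundamentalGroup.map (⟨F, hF.continuous⟩ : C(M, N)) x₀).range.normalCore)),
      HolomorphicSMul (FundamentalGroup N (F x₀) ⧸
          (FundamentalGroup.map (⟨F, hF.continuous⟩ : C(M, N)) x₀).range.normalCore) T ∧
        (∀ a : T, stabilizer (FundamentalGroup N (F x₀) ⧸
          (FundamentalGroup.map (⟨F, hF.continuous⟩ : C(M, N)) x₀).range.normalCore) a = ⊥) ∧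
        MDifferentiable 𝓘(ℂ, ℂ) 𝓘(ℂ, ℂ) t ∧ Surjective t ∧
        (∀ (g : FundamentalGroup N (F x₀) ⧸
          (FundamentalGroup.map (⟨F, hF.continuous⟩ : C(M, N)) x₀).range.normalCore) (a : T), t (g • a) = t a) ∧
        (∀ a b : T, t a = t b ↔ ∃ g : FundamentalGroup N (F x₀) ⧸
          (FundamentalGroup.map (⟨F, hF.continuous⟩ : C(M, N)) x₀).range.normalCore, g • b = a) ∧
        (∀ y, (t ⁻¹' {y}).ncard = (FundamentalGroup.map (⟨F, hF.continuous⟩ : C(M, N)) x₀).range.normalCore.index) ∧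
        Injective (FundamentalGroup.mapOfEq (⟨t, ht.continuous⟩ : C(T, N)) ht₀) ∧
        (FundamentalGroup.mapOfEq (⟨t, ht.continuous⟩ : C(T, N)) ht₀).range =
          (FundamentalGroup.map (⟨F, hF.continuous⟩ : C(M, N)) x₀).range.normalCore ∧
        IsCoveringMap s ∧ MDifferentiable 𝓘(ℂ, ℂ) 𝓘(ℂ, ℂ) s ∧ Surjective s ∧ (∀ a, F (s a) = t a) ∧
        s t₀ = x₀ ∧ IsQuotientCoveringMap s S ∧
        (∀ g, g ∈ S ↔ ∀ a, s (g • a) = s a) ∧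
        (arithGenus T : ℤ) - 1 =
          (FundamentalGroup.map (⟨F, hF.continuous⟩ : C(M, N)) x₀).range.normalCore.index *
            ((arithGenus N : ℤ) - 1) := by
  haveI := finiteIndex_range_map hF hc.exists_apply_ne_of_compactSpace x₀
  exact exists_galois_cover_of_le_range hF hc x₀ _ (Subgroup.normalCore_le _)

omit [T2Space M] in
/-- The normal core of `F_* π₁(M, x₀)` — the group of the Galois closure — is the kernel of the monodromy
representation of `π₁(N, F x₀)` on the fibre `F⁻¹(F x₀)` and has finite index. [cite: HatcherAT2002, §1.3 Prop. 1.39, Exercise 16] -/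
theorem normalCore_range_map_eq_ker_monodromyPerm (hF : MDifferentiable 𝓘(ℂ, ℂ) 𝓘(ℂ, ℂ) F)
    (hc : IsCoveringMap F) (x₀ : M) :
    (FundamentalGroup.map (⟨F, hF.continuous⟩ : C(M, N)) x₀).range.normalCore = (hc.monodromyPerm (F x₀)).ker ∧
      (FundamentalGroup.map (⟨F, hF.continuous⟩ : C(M, N)) x₀).range.normalCore.FiniteIndex := by
  haveI := pathConnectedSpace_of_connectedSpace M
  haveI := finiteIndex_range_map hF hc.exists_apply_ne_of_compactSpace x₀
  refine ⟨?_, inferInstance⟩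
  rw [ker_monodromyPerm_eq_normalCore hc (⟨x₀, rfl⟩ : F ⁻¹' {F x₀})]
  congr 1
  ext γ
  constructor
  · rintro ⟨δ, rfl⟩
    exact ⟨δ, (Literature.AlgebraicTopology.FundamentalGroup.mapOfEq_rfl_apply _ _ δ)⟩
  · rintro ⟨δ, rfl⟩
    exact ⟨δ, (Literature.AlgebraicTopology.FundamentalGroup.mapOfEq_rfl_apply _ _ δ).symm⟩

end RiemannSurface

end Literature.Geometry.Kaehler

end
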